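/-
Copyright (c) 2026 H21 harness. All rights reserved.
Released under Apache 2.0 license as described in the file LICENSE.
-/
import Mathlib
import Literature.AlgebraicGeometry.Resolution.LocalBlowup

/-!
# Frobenius-closing steer — the run's members are F-FINITE (plumbing for K-β6 `SqModSqDescent`)

Context: Steer crux `stmt-ResolutionOfSingularities-16345`, hK4′ β-leaf.  K-β6 (`FrobeniusClosingSteerSqModSqDescent`,
`SqModSq.sq_add_mem_of_hat` / `sq_add_mem_of_adicCompletion`) carries the binder `Module.Finite (frobenius S 2).range S` («`S` is a finite
module over its subring of squares»).  This file discharges it for the rings the leaf meets: localisations at the centre of a valuation of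
finitely generated algebras over a PERFECT field of characteristic `2`.

* `moduleFinite_frobeniusRange` — `K ⊇ k` of characteristic `2`, `k` perfect, `G ⊆ K` finite, `S ≤ K` a subring containing `k` and `G` all of
  whose elements are `a · u⁻¹` with `a, u ∈ k[G]` and `u⁻¹ ∈ S`: then `S = ∑_{J ⊆ G} S² · ∏ J`, so `S` is finite over `(frobenius S 2).range`.
* `moduleFinite_frobeniusRange_locAtCentre` — in particular for `S = locAtCentre A O`, `A` a finitely generated `k`-subalgebra of `K`.

Proof: the `S²`-span `V` of the `2^|G|` square-free monomials in `G` is stable under multiplication by `G` (`g · ∏ J` is `∏ (J ∪ {g})` or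
`g² · ∏ (J ∖ {g})`), by `k` (`c = (c^{1/2})²`, `k` perfect), hence by `k[G]`; and `a · u⁻¹ = (u⁻¹)² · (a u) ∈ V`.
-/

open IsLocalRing
open Literature.AlgebraicGeometry.Resolution

set_option linter.dupNamespace false

namespace Summit.ResolutionOfSingularities.ResolutionOfSingularities.Theorems.SwitchingDichotomy

namespace SqModSq

variable {k K : Type} [Field k] [PerfectField k] [Field K] [Algebra k K] [CharP K 2]

/-- **F-finiteness of fraction-type subrings of `k[G]`** (`k` perfect, characteristic `2`): if every element of the subring `S ⊇ k ∪ G` is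
`a · u⁻¹` with `a, u ∈ k[G]`, `u⁻¹ ∈ S`, then `S` is a finite module over its subring of squares (generated by the square-free monomials
in `G`). [folklore] -/
theorem moduleFinite_frobeniusRange (G : Finset K) (S : Subring K) (hGS : ∀ g ∈ G, g ∈ S)
    (hkS : ∀ c : k, algebraMap k K c ∈ S)
    (hfrac : ∀ s ∈ S, ∃ a ∈ Algebra.adjoin k (G : Set K), ∃ u ∈ Algebra.adjoin k (G : Set K), u⁻¹ ∈ S ∧ s = a * u⁻¹) :
    Module.Finite (frobenius S 2).range S := by
  classical
  haveI : CharP k 2 := (Algebra.charP_iff k K 2).mpr inferInstance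
  -- `k[G] ⊆ S`
  let S' : Subalgebra k K := { S.toSubsemiring with algebraMap_mem' := hkS }
  have hAS : ∀ a ∈ Algebra.adjoin k (G : Set K), a ∈ S := fun a ha =>
    (Algebra.adjoin_le (S := S') (fun g hg => hGS g hg) : Algebra.adjoin k (G : Set K) ≤ S') ha
  -- the square-free monomials and their `S²`-span
  let mono : Finset G → S := fun J => ⟨∏ g ∈ J, (g : K), prod_mem fun g _ => hGS g g.2⟩
  let V : Submodule (frobenius S 2).range S := Submodule.span _ (Set.range mono)
  have hsq : ∀ (s v : S), v ∈ V → s ^ 2 * v ∈ V := fun s v hv => by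
    have : s ^ 2 * v = ((frobenius S 2).rangeRestrict s : (frobenius S 2).range) • v := by
      rw [Algebra.smul_def]
      rfl
    rw [this]
    exact V.smul_mem _ hv
  -- generators act on `V`
  have hgen : ∀ (g : K) (hg : g ∈ G), ∀ v ∈ V, (⟨g, hGS g hg⟩ : S) * v ∈ V := by
    intro g hg v hv
    refine Submodule.span_induction ?_ ?_ ?_ ?_ hv
    · rintro _ ⟨J, rfl⟩
      by_cases hJ : (⟨g, hg⟩ : G) ∈ J
      · have : (⟨g, hGS g hg⟩ : S) * mono J = (⟨g, hGS g hg⟩ : S) ^ 2 * mono (J.erase ⟨g, hg⟩) := by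
          apply Subtype.ext
          change g * ∏ g' ∈ J, (g' : K) = g ^ 2 * ∏ g' ∈ J.erase ⟨g, hg⟩, (g' : K)
          rw [← Finset.mul_prod_erase J (fun g' : G => (g' : K)) hJ]
          ring
        rw [this]
        exact hsq _ _ (Submodule.subset_span ⟨_, rfl⟩)
      · have : (⟨g, hGS g hg⟩ : S) * mono J = mono (insert ⟨g, hg⟩ J) := by
          apply Subtype.ext
          change g * ∏ g' ∈ J, (g' : K) = ∏ g' ∈ insert (⟨g, hg⟩ : G) J, (g' : K)
          rw [Finset.prod_insert hJ]
        rw [this]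
        exact Submodule.subset_span ⟨_, rfl⟩
    · rw [mul_zero]
      exact V.zero_mem
    · intro x y _ _ hx hy
      rw [mul_add]
      exact V.add_mem hx hy
    · intro c x _ hx
      have : (⟨g, hGS g hg⟩ : S) * (c • x) = c • ((⟨g, hGS g hg⟩ : S) * x) := by
        rw [Algebra.smul_def, Algebra.smul_def, mul_left_comm]
      rw [this]
      exact V.smul_mem c hx
  -- `k[G]` acts on `V`
  have hadj : ∀ a ∈ Algebra.adjoin k (G : Set K), ∀ v ∈ V, ∀ ha : a ∈ S, (⟨a, ha⟩ : S) * v ∈ V := by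
    intro a ha
    induction ha using Algebra.adjoin_induction with
    | mem g hg => exact fun v hv _ => hgen g hg v hv
    | algebraMap c =>
      intro v hv hc
      obtain ⟨c', rfl⟩ := (frobeniusEquiv k 2).surjective c
      have : (⟨algebraMap k K (frobeniusEquiv k 2 c'), hc⟩ : S) = (⟨algebraMap k K c', hkS c'⟩ : S) ^ 2 :=
        Subtype.ext (by simp [frobeniusEquiv_apply, frobenius_def, map_pow])
      rw [this]
      exact hsq _ _ hv
    | add a b ha' hb' iha ihb =>
      intro v hv hab
      have h := V.add_mem (iha v hv (hAS a ha')) (ihb v hv (hAS b hb'))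
      have : (⟨a + b, hab⟩ : S) * v = (⟨a, hAS a ha'⟩ : S) * v + (⟨b, hAS b hb'⟩ : S) * v := by
        rw [← add_mul]
        rfl
      rw [this]
      exact h
    | mul a b ha' hb' iha ihb =>
      intro v hv hab
      have h := iha _ (ihb v hv (hAS b hb')) (hAS a ha')
      have : (⟨a * b, hab⟩ : S) * v = (⟨a, hAS a ha'⟩ : S) * ((⟨b, hAS b hb'⟩ : S) * v) := by
        rw [← mul_assoc]
        rfl
      rw [this]
      exact h
  -- every element of `S` lies in `V`
  have h1 : (1 : S) ∈ V := Submodule.subset_span ⟨∅, Subtype.ext (by simp [mono])⟩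
  have hV : ∀ s : S, s ∈ V := by
    intro s
    obtain ⟨a, ha, u, hu, huS, hs⟩ := hfrac s s.2
    have hau : (⟨a * u, hAS _ (mul_mem ha hu)⟩ : S) * 1 ∈ V := hadj (a * u) (mul_mem ha hu) 1 h1 _
    have : s = (⟨u⁻¹, huS⟩ : S) ^ 2 * ((⟨a * u, hAS _ (mul_mem ha hu)⟩ : S) * 1) := by
      apply Subtype.ext
      change (s : K) = (u⁻¹) ^ 2 * ((a * u) * 1)
      rw [hs]
      by_cases hu0 : u = 0
      · simp [hu0]
      · field_simp
    rw [this]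
    exact hsq _ _ hau
  exact ⟨Submodule.fg_def.mpr ⟨Set.range mono, Set.finite_range mono, eq_top_iff.mpr fun s _ => hV s⟩⟩

/-- **The run's members are F-finite**: for a finitely generated `k`-subalgebra `A` of `K` (`k` perfect, characteristic `2`) and a
valuation ring `O` of `K`, the local ring `locAtCentre A O` is a finite module over its subring of squares — the binder
`Module.Finite (frobenius S 2).range S` of K-β6 `SqModSq.sq_add_mem_of_adicCompletion`. [folklore] -/
theorem moduleFinite_frobeniusRange_locAtCentre (A : Subalgebra k K) (hA : A.FG) (O : ValuationSubring K) :
    Module.Finite (frobenius (locAtCentre A.toSubring O) 2).range (locAtCentre A.toSubring O) := by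
  obtain ⟨G, hG⟩ := hA
  refine moduleFinite_frobeniusRange G _ (fun g hg => le_locAtCentre A.toSubring O ?_)
    (fun c => le_locAtCentre A.toSubring O (A.algebraMap_mem c)) fun s hs => ?_
  · rw [Subalgebra.mem_toSubring, ← hG]
    exact Algebra.subset_adjoin hg
  · obtain ⟨y, hy, z, hz, hvz, rfl⟩ := mem_locAtCentre_iff.mp hs
    rw [Subalgebra.mem_toSubring, ← hG] at hy
    refine ⟨y, hy, z, ?_, inv_mem_locAtCentre (le_locAtCentre A.toSubring O hz) hvz, div_eq_mul_inv y z⟩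
    rw [Subalgebra.mem_toSubring, ← hG] at hz
    exact hz

end SqModSq

end Summit.ResolutionOfSingularities.ResolutionOfSingularities.Theorems.SwitchingDichotomy
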